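import Summits.QuantumFields.YangMills.Theorems.BalabanUVNodesN09AxialLetterCutoffFamily
import Summits.QuantumFields.YangMills.Theorems.BalabanUVNodesN09RegularityTowerAnyCritOfLocalRoute

/-!
# NODE N09 [B12] · ROAD B's REGULARITY TOWER FOR THE AXIAL LETTER — the instance of dag-n09-w2's letter-parametric tower at print's (2.3) object «in the axial gauge»:
# `A_j` continuous on every `domAlt_j`, `hreg_j` ∧ `HasContTransportOn` ∧ (F3)_j for all `j < K`, `𝐍_j > 0` and (0.19) on domains — displaying ONLY `hsolν` + the Sel letter's
# continuity (or [B11]'s two-radii binders) + numerics; and «𝐆(V^{(k)}) = 0» at the axial letter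

Cell `pub-ymgap` (YM-PLAN Track A), DAG node N09 [Balaban1987RG1] (= [I]); width seat `pub-ymgap-dag-n09-w5` g7, FILE 3 (sequel of `…N09ContinuousAxialCritCfg` p642976 and
`…N09AxialLetterCutoffFamily` p645030); count-neutral helper keyed to K1⁹ `StabilityBRunRowsAtRecordR13SepCoPHV` = stmt-QuantumFields-27364 (`--kind proof --supports … --as helper`).

WHY.  dag-n09-w2 g5's `…N09RegularityTowerAnyCritOfLocalRoute` (p645251) runs road B for ANY letter family `crit` and ANY cut-off family `χ` carrying six displayed per-step clauses
(`hχm hχ01 hχ1 hfib hcritδ hcrit`); its §3 Sel instance could not be landed (it reproduces the Sel tower token for token).  The AXIAL edition — print's own (2.3) p. 265 «related to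
the minimal configuration … in the axial gauge», the object dag-n09-w5 g6 located for the (2.3) re-point and for FLAG №7's `JInputs.Φ₀` tie — is NOT a restatement: its letter and
cut-off are the ∃-packaged pair of FILE 2 (`exists_axialPair_towerBinders_…`), whose nine conjuncts ARE the tower's six clauses (in order) plus measurability, axiality and
(181)ˢᵒˡ-covariance.  THIS FILE plugs the pair into the tower: for SOME block-axial, (181)ˢᵒˡ-covariant, measurable letter family `crit K` with its (2.9) cut-off `χ`, road B's
whole output holds at every history `g` — `A_j` continuous on `domAlt_j` (`j ≤ K`), `hreg_j` ∧ `HasContTransportOn` ∧ (F3)_j (`j < K`), `𝐍_j > 0` with (0.19) on domains — from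
`hsolν` + `hcritSel` + numerics (§1), or from the tower-shaped two-radii binders `h11 hreg8` + numerics (§2).  §3 records print's «𝐆(V^{(k)}) = 0» for the letter: the gauge-fixing
term of record VANISHES identically at every value of an axial letter (lit-balaban's `gaugeFixFn_eq_zero_of_axialGauge`), so at the witness the β-input's factor `e^{−GF_k∕g_k²}` is `1`.

WHAT IS PROVED (theorems only; 0 `def`, 0 `instance`, 0 `sorry`; axioms standard).
* §1 ★★★ `exists_axialLetter_tower_of_hsolν_of_hcritSel` — `∃ crit χ`: (axial extras, `j < K`) `Measurable (crit K j)` · `AxialGauge (contourOfRecord F N K j) (crit K j W)` ∀ `W` ·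
  (181)ˢᵒˡ; (the tower's clauses) `hχm hχ01 hχ1 hfib hcritδ hcrit`; and FOR EVERY history `g`: `∀ j ≤ K, ContinuousOn A_j domAlt_j` · `∀ j < K, hreg_j ∧ HasContTransportOn ∧ (F3)_j` ·
  (`0 < ν.ε₀ →`) `∀ j < K, 0 < 𝐍_j ∧ (0.19) on domAlt_{j+1}`.
* §2 ★★★ `exists_axialLetter_tower_of_thm1_εbg_of_reg8` (the same from `h11 hreg8 : ∀ k ≤ K, ∀ V ∈ domAlt_k, …` at `εbg` + dag-n09-w1's loop-guard numerics on `α₀`).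
* §3 `gfOfRecord_eq_zero_of_axialGauge` (any axial `V`), ★ `exists_axialCritCfg_gfOfRecord_eq_zero` («𝐆(V^{(k)}(W)) = 0» for EVERY `W`, with the fibre identity on the solvable set).
* §4 (letter-generic (M1)) `fluctDev_gaugeAct_liftTransf_of_covariant` · ★★ `cutoff_gaugeAct_liftTransf_of_covariant` · ★★ `cutoff_liftInvariantOn_solvable_of_covariant` — the
  (2.9)-pattern cut-off of ANY covariant letter (clause (d) of the axial letter; K0c's `critCfgSelOfRecord_gaugeAct` for the offer) is lift-invariant on the solvable set.

HONEST SCOPE ∕ FRAMING.  Count-neutral composition BY NAME (FILE 2 + p645251 + lit-balaban's `B12CriticalPoint23`); the axial letter is an ∃-witness, NO record reads it (adoption =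
K0e ∕ def-T ∕ def-B); [B11] Thm 1 enters ONLY as displayed hypotheses (`hsolν`, `h11`, `hreg8`); all numerics DISPLAYED (the tower's `ε₁ δ α` letters + `0 < εreg`, the (53)-pair at `εreg`, `2εreg ≤ δL²`;
the Federbush letter for `δ` is derived from `hord` + `hGFnum`), asserted of no record; NOTHING of Bałaban's asserted; `hreg`∕(F3) AT THE RECORD (bare `Uk`) NOT discharged; N09 NOT discharged; conjunct 1 (Lemma 4) ∕
FLAG №7 untouched; K0⁷ ∕ K1⁹ ∕ K3⁸ NOT closed; counts unmoved (typed 28∕28 · discharged 5∕28); one finite four-torus programme at fixed `ε = L^{−K}` per run — R4 closes the conditional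
rung `BalabanLadder.UV` only; NOT ℝ⁴ ∕ infinite volume ∕ OS; the Yang–Mills mass gap (Clay) is NOT proved by any of this.
-/

noncomputable section

open Set Filter Topology MeasureTheory

namespace Summit.QuantumFields.YangMills.BalabanUVNodes.N09RegularityTowerAxialLetter

open Literature.MathematicalPhysics.QuantumFieldTheory.Balaban1983to89
open Literature.MathematicalPhysics.QuantumFieldTheory.Balaban1983to89.Node00
open Literature.MathematicalPhysics.QuantumFieldTheory.Balaban1983to89.T4Continuum (T4Family)
open Literature.MathematicalPhysics.QuantumFieldTheory.Balaban1983to89.ExpMeanLog (deltaSU)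
open Literature.MathematicalPhysics.QuantumFieldTheory.Balaban1983to89.FederbushMean (deltaFed)
open B12RTGaugeInvariance254 (liftTransf)
open GaugeField (gaugeAct)
open Summit.QuantumFields.YangMills.BalabanUVNodes.N09ContinuousAxialCritCfg (exists_axialCritCfg)
open Summit.QuantumFields.YangMills.BalabanUVNodes.N09AxialLetterCutoffFamily (exists_axialPair_towerBinders_of_hsolν_of_hcritSel
  exists_axialPair_towerBinders_of_thm1_εbg_of_reg8)
open Summit.QuantumFields.YangMills.BalabanUVNodes.N09RegularityTowerAnyCritOfLocalRoute (continuousOn_effActionHT_anyCrit_all hregAnyCrit_pos_all normConst_anyCrit_pos_and_eq_exp)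

variable {F : T4Family} {N : ℕ} [NeZero N]

/-! ## §1. The tower for the axial letter from the Sel tower's own binders `hsolν` + `hcritSel` and numerics -/

/-- ★★★ **ROAD B's REGULARITY TOWER HOLDS FOR THE AXIAL LETTER** (torus `K`, numerics `ν`, threshold `ε₁`, Prop-2 radius `δ`, loop radius `α`): from `hsolν`, the Sel letter's continuity
`hcritSel : ∀ j < K, ContinuousOn (V^{(j),Sel}) domAlt_{j+1}`, and numerics (`0 < εreg`, the (53)-pair at `εreg`, `2εreg ≤ δL²`, and the tower's own `hε1 hα24 hαδ hαL hn1 hn2 hαB hord hε₀ hGFnum` — the Federbush letter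
`((d·L)²∕4)·δ < δ_N` for the axial normal form's continuity is DERIVED from `hord` and `hGFnum`) there are a letter family `crit` and a cut-off family `χ` such that: `crit K j` is measurable, BLOCK-AXIAL for `contourOfRecord F N K j`
at EVERY field and (181)ˢᵒˡ-covariant (`j < K`); `(crit K, χ)` carry the tower's six displayed clauses; and at EVERY history `g` the tower's three outputs hold — `A_j` continuous on
`domAlt_j` (`j ≤ K`), `hreg_j` ∧ `HasContTransportOn` ∧ (F3)_j (`j < K`), and, when `0 < ν.ε₀`, `𝐍_j > 0` with (0.19) on `domAlt_{j+1}`.  Road B is edition-independent INCLUDING print's axial edition.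
[cite: Balaban1987RG1, (2.3) p.265, (2.9) p.266, (0.19) p.255 and p.259; Balaban1985Averaging, Prop. 2 (53) p.26; Balaban1985Variational, (181) p.307; Balaban1985RegularSpaces, (1.15) p.78] -/
theorem exists_axialLetter_tower_of_hsolν_of_hcritSel (ν : Stage7Numerics) (K : ℕ) {ε₁ δ α : ℝ} (hε : 0 < ν.εreg)
    (hε3 : (143 * (((((F.P K).d + 4 : ℕ) : ℝ)) ^ 2 / 4) ^ 2) * ν.εreg ≤ 1 / 3)
    (hε2 : 2 * ν.εreg ≤ 2 * deltaSU (Fin N) / ((((F.P K).d + 4) * (F.P K).L : ℕ) : ℝ) ^ 2) (hδreg : 2 * ν.εreg ≤ δ * ((F.P K).L : ℝ) ^ 2)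
    (hsolν : ∀ j < K, ∀ W ∈ domAltOfRecord F N ν K (j + 1), UkExists F N K (j + 1) ν.εreg W)
    (hcritSel : ∀ j < K, ContinuousOn (critCfgSelOfRecord F N ν K j) (domAltOfRecord F N ν K (j + 1)))
    (hε1 : 0 < ε₁) (hα24 : α ≤ 1 / 24) (hαδ : α < deltaSU (Fin N)) (hαL : 157 * α < (((F.P K).L : ℝ) ^ ((F.P K).d - 1))⁻¹)
    (hn1 : 1640 * (2 * (((((F.P K).d + 2) * (F.P K).L : ℕ) : ℝ) * ε₁) + ((((F.P K).d + 2) * (F.P K).L : ℕ) : ℝ) ^ 2 / 4 * δ) *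
      (((F.P K).L : ℝ) ^ ((F.P K).d - 1)) ^ 2 ≤ 1)
    (hn2 : 13 * (2 * (((((F.P K).d + 2) * (F.P K).L : ℕ) : ℝ) * ε₁) + ((((F.P K).d + 2) * (F.P K).L : ℕ) : ℝ) ^ 2 / 4 * δ) *
      ((F.P K).L : ℝ) ^ ((F.P K).d - 1) < deltaSU (Fin N))
    (hαB : ((((F.P K).d + 2) * (F.P K).L : ℕ) : ℝ) ^ 2 / 4 *
      (δ + 4 * max ε₁ (10 * (((((F.P K).d + 2) * (F.P K).L : ℕ) : ℝ) * ε₁) * ((F.P K).L : ℝ) ^ ((F.P K).d - 1))) < α)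
    (hord : δ + 4 * max ε₁ (10 * (((((F.P K).d + 2) * (F.P K).L : ℕ) : ℝ) * ε₁) * ((F.P K).L : ℝ) ^ ((F.P K).d - 1)) < ν.ε₀)
    (hε₀ : 0 ≤ ν.ε₀) (hGFnum : ((((F.P K).d * (F.P K).L : ℕ) : ℝ)) ^ 2 / 4 * ν.ε₀ < deltaFed (Fin N)) :
    ∃ (crit : (K j : ℕ) → GaugeField (F.P K) (j + 1) (SU N) → GaugeField (F.P K) j (SU N))
      (χ : (K : ℕ) → (ℕ → ℝ) → (k : ℕ) → Density (F.P K) k (SU N)),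
      -- the axial extras
      (∀ j < K, Measurable (crit K j)) ∧
      (∀ j < K, ∀ W, AxialGauge (contourOfRecord F N K j) (crit K j W)) ∧
      (∀ j < K, ∀ (v : GaugeTransf (F.P K) (j + 1) (SU N)) (W : GaugeField (F.P K) (j + 1) (SU N)),
        UkExists F N K (j + 1) ν.εreg W → UniqueUkOrbit F N K (j + 1) ν.εreg W → crit K j (gaugeAct v W) = gaugeAct (liftTransf v) (crit K j W)) ∧
      -- the tower's six displayed clauses, carried by the pair
      (∀ (g : ℕ → ℝ) (j : ℕ), Measurable (χ K g j)) ∧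
      (∀ (g : ℕ → ℝ) (j : ℕ) (U : GaugeField (F.P K) j (SU N)), χ K g j U = 0 ∨ χ K g j U = 1) ∧
      (∀ (g : ℕ → ℝ), ∀ j < K, ∀ V : GaugeField (F.P K) j (SU N),
        χ K g j V = 1 ↔ ∀ b : PBond (F.P K) j, ¬ IsB0 b → dist1 ((crit K j ((avOfRecord F N K j).avg V) b)⁻¹ * V b) < ε₁) ∧
      (∀ j < K, ∀ W ∈ domAltOfRecord F N ν K (j + 1), (avOfRecord F N K j).avg (crit K j W) = W) ∧
      (∀ j < K, ∀ W ∈ domAltOfRecord F N ν K (j + 1), PlaqSmall δ (crit K j W)) ∧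
      (∀ j < K, ContinuousOn (crit K j) (domAltOfRecord F N ν K (j + 1))) ∧
      -- the tower's outputs, at every history
      ∀ g : ℕ → ℝ,
        (∀ j, j ≤ K → ContinuousOn (effActionHT F N (TcanOfRecord F N) χ K g j) (domAltOfRecord F N ν K j)) ∧
        (∀ j < K, (domAltOfRecord F N ν K (j + 1) ⊆ regSetOfRecord F N K j (betaInputOfRecord F N (TcanOfRecord F N) χ K g j) ∧
            HasContTransportOn F N K j (betaInputOfRecord F N (TcanOfRecord F N) χ K g j) (domAltOfRecord F N ν K (j + 1))) ∧
          ∀ V ∈ domAltOfRecord F N ν K (j + 1), 0 < TcanOfRecord F N K j (betaInputOfRecord F N (TcanOfRecord F N) χ K g j) V) ∧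
        (0 < ν.ε₀ → ∀ j < K, 0 < normConstHT F N (TcanOfRecord F N) χ K g j ∧
          ∀ V ∈ domAltOfRecord F N ν K (j + 1),
            TcanOfRecord F N K j (betaInputOfRecord F N (TcanOfRecord F N) χ K g j) V
              = normConstHT F N (TcanOfRecord F N) χ K g j * Real.exp (effActionHT F N (TcanOfRecord F N) χ K g (j + 1) V)) := by
  have hL0 : (0 : ℝ) < (F.P K).L := by exact_mod_cast (F.P K).L_pos
  have hδ : 0 ≤ δ := by
    have h2 : 0 ≤ δ * ((F.P K).L : ℝ) ^ 2 := le_trans (by positivity) hδreg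
    exact nonneg_of_mul_nonneg_left h2 (by positivity)
  -- the Federbush letter for `δ` follows from `hord` (`δ < ν.ε₀`) and `hGFnum`
  have hδFed : ((((F.P K).d * (F.P K).L : ℕ) : ℝ)) ^ 2 / 4 * δ < deltaFed (Fin N) := by
    have hmax : 0 ≤ 4 * max ε₁ (10 * (((((F.P K).d + 2) * (F.P K).L : ℕ) : ℝ) * ε₁) * ((F.P K).L : ℝ) ^ ((F.P K).d - 1)) :=
      mul_nonneg (by norm_num) (le_trans hε1.le (le_max_left _ _))
    have hδε : δ ≤ ν.ε₀ := by linarith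
    exact lt_of_le_of_lt (mul_le_mul_of_nonneg_left hδε (by positivity)) hGFnum
  obtain ⟨crit, χ, hχm, hχ01, hχ1, hfib, hcritδ, hcrit, hm, hax, hcov⟩ :=
    exists_axialPair_towerBinders_of_hsolν_of_hcritSel (F := F) (N := N) ν ε₁ K hε hε3 hε2 hδreg hδFed hsolν hcritSel
  refine ⟨crit, χ, hm, hax, hcov, hχm, hχ01, hχ1, hfib, hcritδ, hcrit, fun g => ⟨?_, ?_, fun hε₀' => ?_⟩⟩
  · exact continuousOn_effActionHT_anyCrit_all ν K g (crit K) χ hε1 hδ hα24 hαδ hαL hn1 hn2 hαB hord hε₀ hGFnum (hχm g) (hχ01 g) (hχ1 g) hfib hcritδ hcrit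
  · exact hregAnyCrit_pos_all ν K g (crit K) χ hε1 hδ hα24 hαδ hαL hn1 hn2 hαB hord hε₀ hGFnum (hχm g) (hχ01 g) (hχ1 g) hfib hcritδ hcrit
  · exact normConst_anyCrit_pos_and_eq_exp ν K g (crit K) χ hε₀' hε1 hδ hα24 hαδ hαL hn1 hn2 hαB hord hGFnum (hχm g) (hχ01 g) (hχ1 g) hfib hcritδ hcrit

/-! ## §2. The tower for the axial letter from the tower-shaped two-radii binders + numerics only -/

/-- ★★★ **… FROM [B11] THM 1's TWO-RADII BINDERS + NUMERICS ONLY**: with `h11 hreg8 : ∀ k ≤ K, ∀ V ∈ domAlt_k, …` at the background radius `εbg` (N07's), `εreg < εbg`, `εreg < α₀`,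
`α₀` (53)-admissible with dag-n09-w1's two loop guards on `2α₀`, and the numerics of §1: the same conclusion — for the axial edition road B displays exactly what it displays for the offer.
[cite: Balaban1987RG1, (2.3) p.265, (2.9) p.266, (0.19) p.255 and p.259; Balaban1985Variational, Thm 1 (6), (8) p.279 and (181) p.307; Balaban1985Averaging, Prop. 2 (53) p.26] -/
theorem exists_axialLetter_tower_of_thm1_εbg_of_reg8 (ν : Stage7Numerics) (εbg : ℝ) (K : ℕ) {α₀ ε₁ δ α : ℝ} (hlt : ν.εreg < εbg) (he : ν.εreg < α₀)
    (hα : 0 < α₀) (hα3 : (143 * (((((F.P K).d + 4 : ℕ) : ℝ)) ^ 2 / 4) ^ 2) * α₀ ≤ 1 / 3)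
    (hα2 : 2 * α₀ ≤ 2 * deltaSU (Fin N) / ((((F.P K).d + 4) * (F.P K).L : ℕ) : ℝ) ^ 2)
    (hα024 : ((((F.P K).d + 2) * (F.P K).L : ℕ) : ℝ) ^ 2 / 4 * (2 * α₀) ≤ 1 / 24)
    (hα0L : 157 * (((((F.P K).d + 2) * (F.P K).L : ℕ) : ℝ) ^ 2 / 4 * (2 * α₀)) < (((F.P K).L : ℝ) ^ ((F.P K).d - 1))⁻¹)
    (hε : 0 < ν.εreg) (hε3 : (143 * (((((F.P K).d + 4 : ℕ) : ℝ)) ^ 2 / 4) ^ 2) * ν.εreg ≤ 1 / 3)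
    (hε2 : 2 * ν.εreg ≤ 2 * deltaSU (Fin N) / ((((F.P K).d + 4) * (F.P K).L : ℕ) : ℝ) ^ 2) (hδreg : 2 * ν.εreg ≤ δ * ((F.P K).L : ℝ) ^ 2)
    (h11 : ∀ k, k ≤ K → ∀ V ∈ domAltOfRecord F N ν K k, UkExists F N K k εbg V ∧ UniqueUkOrbit F N K k εbg V)
    (hreg8 : ∀ k, k ≤ K → ∀ V ∈ domAltOfRecord F N ν K k, Uk F N K k εbg V ∈ bgReg F N K k ν.εreg)
    (hε1 : 0 < ε₁) (hα24 : α ≤ 1 / 24) (hαδ : α < deltaSU (Fin N)) (hαL : 157 * α < (((F.P K).L : ℝ) ^ ((F.P K).d - 1))⁻¹)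
    (hn1 : 1640 * (2 * (((((F.P K).d + 2) * (F.P K).L : ℕ) : ℝ) * ε₁) + ((((F.P K).d + 2) * (F.P K).L : ℕ) : ℝ) ^ 2 / 4 * δ) *
      (((F.P K).L : ℝ) ^ ((F.P K).d - 1)) ^ 2 ≤ 1)
    (hn2 : 13 * (2 * (((((F.P K).d + 2) * (F.P K).L : ℕ) : ℝ) * ε₁) + ((((F.P K).d + 2) * (F.P K).L : ℕ) : ℝ) ^ 2 / 4 * δ) *
      ((F.P K).L : ℝ) ^ ((F.P K).d - 1) < deltaSU (Fin N))
    (hαB : ((((F.P K).d + 2) * (F.P K).L : ℕ) : ℝ) ^ 2 / 4 *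
      (δ + 4 * max ε₁ (10 * (((((F.P K).d + 2) * (F.P K).L : ℕ) : ℝ) * ε₁) * ((F.P K).L : ℝ) ^ ((F.P K).d - 1))) < α)
    (hord : δ + 4 * max ε₁ (10 * (((((F.P K).d + 2) * (F.P K).L : ℕ) : ℝ) * ε₁) * ((F.P K).L : ℝ) ^ ((F.P K).d - 1)) < ν.ε₀)
    (hε₀ : 0 ≤ ν.ε₀) (hGFnum : ((((F.P K).d * (F.P K).L : ℕ) : ℝ)) ^ 2 / 4 * ν.ε₀ < deltaFed (Fin N)) :
    ∃ (crit : (K j : ℕ) → GaugeField (F.P K) (j + 1) (SU N) → GaugeField (F.P K) j (SU N))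
      (χ : (K : ℕ) → (ℕ → ℝ) → (k : ℕ) → Density (F.P K) k (SU N)),
      (∀ j < K, Measurable (crit K j)) ∧
      (∀ j < K, ∀ W, AxialGauge (contourOfRecord F N K j) (crit K j W)) ∧
      (∀ j < K, ∀ (v : GaugeTransf (F.P K) (j + 1) (SU N)) (W : GaugeField (F.P K) (j + 1) (SU N)),
        UkExists F N K (j + 1) ν.εreg W → UniqueUkOrbit F N K (j + 1) ν.εreg W → crit K j (gaugeAct v W) = gaugeAct (liftTransf v) (crit K j W)) ∧
      (∀ (g : ℕ → ℝ) (j : ℕ), Measurable (χ K g j)) ∧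
      (∀ (g : ℕ → ℝ) (j : ℕ) (U : GaugeField (F.P K) j (SU N)), χ K g j U = 0 ∨ χ K g j U = 1) ∧
      (∀ (g : ℕ → ℝ), ∀ j < K, ∀ V : GaugeField (F.P K) j (SU N),
        χ K g j V = 1 ↔ ∀ b : PBond (F.P K) j, ¬ IsB0 b → dist1 ((crit K j ((avOfRecord F N K j).avg V) b)⁻¹ * V b) < ε₁) ∧
      (∀ j < K, ∀ W ∈ domAltOfRecord F N ν K (j + 1), (avOfRecord F N K j).avg (crit K j W) = W) ∧
      (∀ j < K, ∀ W ∈ domAltOfRecord F N ν K (j + 1), PlaqSmall δ (crit K j W)) ∧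
      (∀ j < K, ContinuousOn (crit K j) (domAltOfRecord F N ν K (j + 1))) ∧
      ∀ g : ℕ → ℝ,
        (∀ j, j ≤ K → ContinuousOn (effActionHT F N (TcanOfRecord F N) χ K g j) (domAltOfRecord F N ν K j)) ∧
        (∀ j < K, (domAltOfRecord F N ν K (j + 1) ⊆ regSetOfRecord F N K j (betaInputOfRecord F N (TcanOfRecord F N) χ K g j) ∧
            HasContTransportOn F N K j (betaInputOfRecord F N (TcanOfRecord F N) χ K g j) (domAltOfRecord F N ν K (j + 1))) ∧
          ∀ V ∈ domAltOfRecord F N ν K (j + 1), 0 < TcanOfRecord F N K j (betaInputOfRecord F N (TcanOfRecord F N) χ K g j) V) ∧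
        (0 < ν.ε₀ → ∀ j < K, 0 < normConstHT F N (TcanOfRecord F N) χ K g j ∧
          ∀ V ∈ domAltOfRecord F N ν K (j + 1),
            TcanOfRecord F N K j (betaInputOfRecord F N (TcanOfRecord F N) χ K g j) V
              = normConstHT F N (TcanOfRecord F N) χ K g j * Real.exp (effActionHT F N (TcanOfRecord F N) χ K g (j + 1) V)) := by
  have hL0 : (0 : ℝ) < (F.P K).L := by exact_mod_cast (F.P K).L_pos
  have hδ : 0 ≤ δ := by
    have h2 : 0 ≤ δ * ((F.P K).L : ℝ) ^ 2 := le_trans (by positivity) hδreg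
    exact nonneg_of_mul_nonneg_left h2 (by positivity)
  -- the Federbush letter for `δ` follows from `hord` (`δ < ν.ε₀`) and `hGFnum`
  have hδFed : ((((F.P K).d * (F.P K).L : ℕ) : ℝ)) ^ 2 / 4 * δ < deltaFed (Fin N) := by
    have hmax : 0 ≤ 4 * max ε₁ (10 * (((((F.P K).d + 2) * (F.P K).L : ℕ) : ℝ) * ε₁) * ((F.P K).L : ℝ) ^ ((F.P K).d - 1)) :=
      mul_nonneg (by norm_num) (le_trans hε1.le (le_max_left _ _))
    have hδε : δ ≤ ν.ε₀ := by linarith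
    exact lt_of_le_of_lt (mul_le_mul_of_nonneg_left hδε (by positivity)) hGFnum
  obtain ⟨crit, χ, hχm, hχ01, hχ1, hfib, hcritδ, hcrit, hm, hax, hcov⟩ :=
    exists_axialPair_towerBinders_of_thm1_εbg_of_reg8 (F := F) (N := N) ν ε₁ εbg K hlt he hα hα3 hα2 hα024 hα0L hε hε3 hε2 hδreg hδFed h11 hreg8
  refine ⟨crit, χ, hm, hax, hcov, hχm, hχ01, hχ1, hfib, hcritδ, hcrit, fun g => ⟨?_, ?_, fun hε₀' => ?_⟩⟩
  · exact continuousOn_effActionHT_anyCrit_all ν K g (crit K) χ hε1 hδ hα24 hαδ hαL hn1 hn2 hαB hord hε₀ hGFnum (hχm g) (hχ01 g) (hχ1 g) hfib hcritδ hcrit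
  · exact hregAnyCrit_pos_all ν K g (crit K) χ hε1 hδ hα24 hαδ hαL hn1 hn2 hαB hord hε₀ hGFnum (hχm g) (hχ01 g) (hχ1 g) hfib hcritδ hcrit
  · exact normConst_anyCrit_pos_and_eq_exp ν K g (crit K) χ hε₀' hε1 hδ hα24 hαδ hαL hn1 hn2 hαB hord hGFnum (hχm g) (hχ01 g) (hχ1 g) hfib hcritδ hcrit

/-! ## §3. «𝐆(V^{(k)}) = 0»: the gauge-fixing term of record vanishes at every value of an axial letter -/

/-- **THE GAUGE-FIXING TERM OF RECORD VANISHES ON AXIAL FIELDS**: `AxialGauge (contourOfRecord F N K k) V → GF_k(V) = 0` — every summand `1 − Re tr U(y,x)` of (0.19) is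
`1 − Re tr 1 = 0` (lit-balaban's `gaugeFixFn_eq_zero_of_axialGauge` at def-B's contour system). [cite: Balaban1987RG1, (2.2)–(2.3) p.265 and (0.17)–(0.19) p.255] -/
theorem gfOfRecord_eq_zero_of_axialGauge {K k : ℕ} {V : GaugeField (F.P K) k (SU N)} (hV : AxialGauge (contourOfRecord F N K k) V) :
    gfOfRecord F N K k V = 0 :=
  B12CriticalPoint23.gaugeFixFn_eq_zero_of_axialGauge (contourOfRecord F N K k) hV Finset.univ

/-- ★ **«𝐆(V^{(k)}(W)) = 0» FOR THE AXIAL LETTER, AT EVERY `W`** (why (2.5) p. 266 starts at SECOND order in `B′`): FILE 1's axial letter (`k + 1 ≤ m + K`) has vanishing gauge-fixing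
term of record everywhere, and lies in the fibre over `W` on the solvable set. [cite: Balaban1987RG1, (2.3) p.265 and (2.5) p.266] -/
theorem exists_axialCritCfg_gfOfRecord_eq_zero (ν : Stage7Numerics) {K k : ℕ} (hk : k + 1 ≤ (F.P K).m + (F.P K).K) :
    ∃ crit : GaugeField (F.P K) (k + 1) (SU N) → GaugeField (F.P K) k (SU N),
      Measurable crit ∧ (∀ W, UkExists F N K (k + 1) ν.εreg W → (avOfRecord F N K k).avg (crit W) = W) ∧
      (∀ W, AxialGauge (contourOfRecord F N K k) (crit W)) ∧ ∀ W, gfOfRecord F N K k (crit W) = 0 := by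
  obtain ⟨crit, ha, hb, hc, -⟩ := exists_axialCritCfg (F := F) (N := N) ν hk
  exact ⟨crit, ha, hb, hc, fun W => gfOfRecord_eq_zero_of_axialGauge (hc W)⟩

/-! ## §4. (M1) for an ARBITRARY covariant letter: its (2.9)-pattern cut-off is lift-invariant — the `LiftInvariant` face a re-pointed junction asks of `χ`, letter-generically -/

/-- **EVERY FLUCTUATION VARIABLE OF A COVARIANT LETTER IS UNCHANGED UNDER THE LIFT**: if `c((M V)^v) = (c (M V))^{v∘blockOf}` at the field `V` (clause (d) of the axial letter at
`W := M V`; K0c's `critCfgSelOfRecord_gaugeAct` for the offer), then `dist1 ((c (M V^{v∘B}) b)⁻¹·V^{v∘B}(b)) = dist1 ((c (M V) b)⁻¹·V(b))` for every bond — `M(V^{v∘B}) = (M V)^v`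
(`avg_gaugeAct_liftTransf`) and `dist1` is conjugation invariant (K0c's `fluctDevSelOfRecord_gaugeAct_liftTransf`, letter-generic). [cite: Balaban1987RG1, (2.1) p.265 and (0.13) p.254] -/
theorem fluctDev_gaugeAct_liftTransf_of_covariant {K k : ℕ} (hk : k + 1 ≤ (F.P K).m + (F.P K).K)
    {c : GaugeField (F.P K) (k + 1) (SU N) → GaugeField (F.P K) k (SU N)} (v : GaugeTransf (F.P K) (k + 1) (SU N)) {V : GaugeField (F.P K) k (SU N)}
    (hcov : c (gaugeAct v ((avOfRecord F N K k).avg V)) = gaugeAct (liftTransf v) (c ((avOfRecord F N K k).avg V))) (b : PBond (F.P K) k) :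
    dist1 ((c ((avOfRecord F N K k).avg (gaugeAct (liftTransf v) V)) b)⁻¹ * gaugeAct (liftTransf v) V b) =
      dist1 ((c ((avOfRecord F N K k).avg V) b)⁻¹ * V b) := by
  rw [B12RTGaugeInvariance254.avg_gaugeAct_liftTransf hk, hcov]
  set c₀ := c ((avOfRecord F N K k).avg V) b
  have h : (gaugeAct (liftTransf v) (c ((avOfRecord F N K k).avg V)) b)⁻¹ * gaugeAct (liftTransf v) V b =
      liftTransf v b.tgt * (c₀⁻¹ * V b) * (liftTransf v b.tgt)⁻¹ := by
    simp only [GaugeField.gaugeAct, c₀, mul_inv_rev, inv_inv]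
    group
  rw [h, GaugeGroup.dist1_conj]

/-- ★★ **(M1) AT ONE FIELD FOR ANY COVARIANT LETTER AND ANY CUT-OFF READING (2.9)**: a `{0,1}`-valued density `χk` with `χk V = 1 ↔ ∀ b ∉ b₀, dist1 ((c (M V) b)⁻¹·V b) < ε₁` (the
displayed `hχ01`∕`hχ1` of road B, e.g. FILE 2's axial cut-off) satisfies `χk (V^{v∘blockOf}) = χk V` at every `V` where `c` is covariant as above.
[cite: Balaban1987RG1, (2.9) p.266; Balaban1985Variational, (181) p.307] -/
theorem cutoff_gaugeAct_liftTransf_of_covariant {K k : ℕ} (hk : k + 1 ≤ (F.P K).m + (F.P K).K)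
    {c : GaugeField (F.P K) (k + 1) (SU N) → GaugeField (F.P K) k (SU N)} {χk : Density (F.P K) k (SU N)} {ε₁ : ℝ}
    (hχ01 : ∀ U, χk U = 0 ∨ χk U = 1)
    (hχ1 : ∀ V, χk V = 1 ↔ ∀ b : PBond (F.P K) k, ¬ IsB0 b → dist1 ((c ((avOfRecord F N K k).avg V) b)⁻¹ * V b) < ε₁)
    (v : GaugeTransf (F.P K) (k + 1) (SU N)) {V : GaugeField (F.P K) k (SU N)}
    (hcov : c (gaugeAct v ((avOfRecord F N K k).avg V)) = gaugeAct (liftTransf v) (c ((avOfRecord F N K k).avg V))) :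
    χk (gaugeAct (liftTransf v) V) = χk V := by
  have hiff : χk (gaugeAct (liftTransf v) V) = 1 ↔ χk V = 1 := by
    rw [hχ1, hχ1]
    exact forall_congr' fun b => imp_congr_right fun _ => by rw [fluctDev_gaugeAct_liftTransf_of_covariant hk v hcov b]
  rcases hχ01 (gaugeAct (liftTransf v) V) with h0 | h1
  · rcases hχ01 V with h0' | h1'
    · rw [h0, h0']
    · exact absurd (hiff.2 h1') (by rw [h0]; exact zero_ne_one)
  · rw [h1, (hiff.1 h1).symm]

/-- ★★ **(M1) ON THE SOLVABLE SET FOR ANY LETTER COVARIANT ON `UkExists ∧ UniqueUkOrbit`** (clause (d) of the axial letter verbatim; [B11] uniqueness on the solvable set DISPLAYED as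
`hsolU`): the cut-off is lift-invariant at every `V` whose average is solvable — the `hχinv`∕`LiftInvariantOn` face of the junction for a re-pointed record, letter-generically.
[cite: Balaban1987RG1, (2.9) p.266; Balaban1985Variational, Thm 1 p.279 and (181) p.307] -/
theorem cutoff_liftInvariantOn_solvable_of_covariant (ν : Stage7Numerics) {K k : ℕ} (hk : k + 1 ≤ (F.P K).m + (F.P K).K)
    {c : GaugeField (F.P K) (k + 1) (SU N) → GaugeField (F.P K) k (SU N)} {χk : Density (F.P K) k (SU N)} {ε₁ : ℝ}
    (hχ01 : ∀ U, χk U = 0 ∨ χk U = 1)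
    (hχ1 : ∀ V, χk V = 1 ↔ ∀ b : PBond (F.P K) k, ¬ IsB0 b → dist1 ((c ((avOfRecord F N K k).avg V) b)⁻¹ * V b) < ε₁)
    (hcov : ∀ (v : GaugeTransf (F.P K) (k + 1) (SU N)) (W : GaugeField (F.P K) (k + 1) (SU N)),
      UkExists F N K (k + 1) ν.εreg W → UniqueUkOrbit F N K (k + 1) ν.εreg W → c (gaugeAct v W) = gaugeAct (liftTransf v) (c W))
    (hsolU : ∀ W : GaugeField (F.P K) (k + 1) (SU N), UkExists F N K (k + 1) ν.εreg W → UniqueUkOrbit F N K (k + 1) ν.εreg W) :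
    ∀ (v : GaugeTransf (F.P K) (k + 1) (SU N)) (V : GaugeField (F.P K) k (SU N)), UkExists F N K (k + 1) ν.εreg ((avOfRecord F N K k).avg V) →
      χk (gaugeAct (liftTransf v) V) = χk V :=
  fun v _ hV => cutoff_gaugeAct_liftTransf_of_covariant hk hχ01 hχ1 v (hcov v _ hV (hsolU _ hV))

end Summit.QuantumFields.YangMills.BalabanUVNodes.N09RegularityTowerAxialLetter
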